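import Summits.QuantumFields.YangMills.Theorems.UnitScaleTiltProp7BlockPoincareKerTopMean
import HarnessLib

/-!
# Route `UnitScaleTilt`, crux «MinimiserStabilityRegPr» (stmt-QuantumFields-19200, stub EX), positivity block, the LOD ∕ Combes–Thomas line of ★p1 g24's
# `LOCATE-P349-CT` (★★OWNER RULINGS №33 ∕ №34) — **THE TOP NESTED COVARIANT MEAN `Q″` OF RECORD IS BLOCK-LOCAL: `(Q″λ)(y)` READS `λ` ON THE BLOCK `B^{K−n}(y)` ONLY;
# HENCE `ker Q″` IS A PRODUCT OVER BLOCKS AND THE ORTHOGONAL PROJECTION ONTO `ker Q″` COMMUTES WITH EVERY BLOCK CUT (its off-block matrix entries vanish)**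
# (width seat `ym3-torus-px17` gen 8, 2026-08-29; memo `LOCATE-L2loc-px17g8.md`, 19200 evidence #49)

Cell `ym3-torus` (HUMAN RULING D-0037: YM₃ on T³ is ladder rung R3 — NOT d = 4, NOT infinite volume, NOT a mass gap, NOT Clay).  THEOREMS ONLY (0 `def`, 0 `sorry`);
`--supports stmt-QuantumFields-19200 --as helper`, count-neutral.  HONEST LABEL (№33 (6) ∕ №34): a structural letter of the curved γ-row supplier line (LOD localisation; «no
RANDOM-WALK organ; ONE Thm 3.1-class Agmon brick (L3′) inside, Track A road cited»); nothing of (L2′)–(L5′), [Balaban1985BackgroundPropagators] (3.49), Thm 3.1 ∕ 3.3, `h349`, `hGF`,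
EX or the crux is proved here.

THE POINT.  The `Q″` of record (✓`Prop7NSIntertwinerOfRecord.exists_intertwiner_of_regPr`: the top of the `meanCLM` recursion of ✓`QTwS_gaugeDir_of_avgSeq` with the stair transports
of the background tower) is consumed by every architecture of the line through ONE combinatorial fact: the recursion step at a coarse site `y` reads the previous level at the centre
`emb y` and at the stair end-points `transl (emb y) (disp (stairWord σ (off r))) = blockSite y r` (✓`Prop7FrameLevelOnto.transl_emb_disp_stairWord_eq_blockSite`), all inside the
block of `y` (✓`Site.blockOf_emb`, ✓`Site.blockOf_blockSite`); composing along `iterBlockOf (j+1) = blockOf ∘ iterBlockOf j` (lit ✓`B5Eq118OneStroke`), `(Q″λ)(y)` depends on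
`λ|_{B^{K−n}(y)}` alone — for ANY background and ANY transports (no `RegPr`, no `ε₀`).  Consequences in the weighted `L²` letters of the lane (`SiteL2K`, `toL2S`; the pairing is the
pointwise sum ✓`inner_toL2S`): the cut `λ ↦ 𝟙_{B(y)}·λ` maps `ker Q″` into itself and is a symmetric operator, so (§2, Mathlib: a symmetric map preserving a subspace commutes with its
`starProjection`) the orthogonal projection `P_N` onto `N = ker Q″` COMMUTES WITH BLOCK CUTS: `P_N(𝟙_{B(y)}λ) = 𝟙_{B(y)}·P_Nλ`.  Equivalently the matrix entries of `P_N` between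
site-supported vectors in different `(K−n)`-blocks VANISH — the `hPr : 0 < d i l → Pm i l = 0` hypothesis of ✓`Prop7ProjRangeKernelDecayCT.R_decay` (p746438) in any block-adapted basis,
the reason `[Q″†Q″, e^{μφ}] = 0` for block-constant weights in the Agmon brick (L3′), and the locality in `y` of ★p1's assembly `P(x,x′) = Σ_{y,y′}(G_aQ″†e_y)(x)·M⁻¹(y,y′)·(G_aQ″†e_{y′})(x′)`
((L5′)).  §3 also records the coercivity letter the line's `accretive_S` ∕ Agmon cores take on `N`: `‖P_N v‖² ≤ 2‖D_{U₀}P_N v‖²` and `‖P_N v‖ ≤ 2‖Δ^η_{U₀}P_N v‖` at `RegPr`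
(✓p746531 (L1) + ✓`inner_covLapSite` + Cauchy–Schwarz; `c = ½`).

WHAT IS PROVED (ns `…Theorems.Prop7TopMeanBlockLocal`).
* §1 (generic `P : Params`, complete normed `ℂ`-algebra `𝔸`, ANY transports `T j y i : 𝔸ˣ`) ★`avgSeq_apply_eq_of_eqOn_iterBlock` — two averaging sequences (same recursion) whose
  level-`0` data agree on `B^j(y)` agree at `(j, y)` (`j ≤ m + K`).
* §2 (Mathlib-only) ★`starProjection_apply_of_isSymmetric_of_mapsTo` — `T` symmetric with `T(K) ⊆ K` ⟹ `K.starProjection (T v) = T (K.starProjection v)`.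
* §3 (T³ member; `Q''` ANY `ℂ`-linear map with clause (iv) of ✓`exists_intertwiner_of_regPr` VERBATIM — the `hseq` of ✓p746531): ★★`topMean_apply_eq_of_eqOn_iterBlock`,
  ★★`topMean_cut` (`Q''(toL2S (𝟙_{B(y)}λ)) = Pi.single y ((Q''(toL2S λ)) y)`), ★`topMean_cut_eq_zero`, ★`topMean_eq_zero_iff_forall_cut`, ★★★`starProjection_ker_cut_comm`,
  ★★`starProjection_ker_apply_eq_zero_off_block`, ★★`inner_starProjection_ker_eq_zero_of_support` ∕ `…_of_iterBlockOf_ne` (off-block entries of `P_N` vanish),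
  ★`normSq_starProjection_ker_le_two_mul` ∕ ★`norm_starProjection_ker_le_two_mul_norm_covLapSite` (coercivity on `N`, at `RegPr`, `10⁷L³ε₀ ≤ 1`).
HONEST SCOPE.  Combinatorics of the recursion + Hilbert-space bookkeeping; NO adjoint `Q″†` statement (the coarse side `Site (F.P K) (K−n) → M₂` carries no pairing of record yet), NO
entry size, NO decay; nothing continuum ∕ OS ∕ mass-gap ∕ Clay.

References: T. Bałaban, CMP **99** (1985) 389–434 [Balaban1985BackgroundPropagators] ((3.19) p.393, (3.21) p.394, (3.49) p.399, (3.114)–(3.115) p.418); CMP **98** (1985) 17–51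
[Balaban1985Averaging] ((97) p.32); CMP **95** (1984) 17–40 [Balaban1984PropagatorsI] ((1.16)–(1.18) p.20, the blocks `B^k(y)`); CMP **109** (1987) 249–301 [Balaban1987RG1]
((0.3)–(0.4) pp.252–253, the block sites of the averaging).
-/

set_option autoImplicit false

noncomputable section

open scoped BigOperators InnerProductSpace ComplexConjugate Matrix.Norms.L2Operator

namespace Summit.QuantumFields.YangMills.Theorems.Prop7TopMeanBlockLocal

open Literature.MathematicalPhysics.QuantumFieldTheory.Balaban1983to89
open Literature.MathematicalPhysics.QuantumFieldTheory.Balaban1983to89.T3ContinuumYM3Torus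
open T4Continuum BlockAveraging
open BlockAveraging (Idx)
open B7Prop1Explicit (disp)
open B10Eq27TorusAxialLog (holT transl)
open B7TransferAnalyticMean (meanCLM)
open B9Eq311L2Pairing (WL2)
open B11Eq103H1Complex (SiteL2K)
open B5Eq118OneStroke (iterBlockOf iterBlockOf_zero iterBlockOf_succ)
open T3PrintedRegularMinimiser (RegPr)
open T3SectALandauChart (bgUnits)
open Summit.QuantumFields.YangMills.Theorems.Prop8Chart (emlIterU)
open Summit.QuantumFields.YangMills.Theorems.Prop7SectET3Transport (periodsT3)
open Summit.QuantumFields.YangMills.Theorems.Prop7SectET3HilbertLetters (W₂ toL2S DL2 covLapSite inner_covLapSite)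
open Summit.QuantumFields.YangMills.Theorems.Prop7SectET3RealCoordSums (inner_toL2S)
open Summit.QuantumFields.YangMills.Theorems.Prop7FrameLevelOnto (transl_emb_disp_stairWord_eq_blockSite)
open Summit.QuantumFields.YangMills.Theorems.Prop7BlockPoincareKerTopMean (normSq_le_two_mul_normSq_DL2_of_topMean_eq_zero)

/-! ## §1 The averaging recursion is block-local (any lattice parameters, any fibre algebra, any transports) -/

section Generic

variable {P : Params} {𝔸 : Type*} [NormedRing 𝔸] [NormedAlgebra ℂ 𝔸]

/-- ★ **THE NESTED MEAN AT `(j, y)` READS THE START ON THE BLOCK `B^j(y)` ONLY.**  Two averaging sequences `ns`, `ns'` of the `meanCLM` recursion of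
✓`QTwS_gaugeDir_of_avgSeq` with the SAME transports `T j y i` (arbitrary units), whose level-`0` data agree on `B^j(y) = {x : iterBlockOf j x = y}`, agree at `(j, y)` — the step at `y`
reads level `j` at `emb y` and at the stair end-points `blockSite y r`, all in the block of `y` (standing range `j ≤ m + K`).
[cite: Balaban1985BackgroundPropagators, (3.19) p.393; Balaban1987RG1, (0.3)-(0.4) pp.252-253; Balaban1984PropagatorsI, (1.16)-(1.18) p.20] -/
theorem avgSeq_apply_eq_of_eqOn_iterBlock (T : (j : ℕ) → Site P (j + 1) → Idx P → 𝔸ˣ) (ns ns' : (j : ℕ) → Site P j → 𝔸)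
    (hns : ∀ (j : ℕ) (y : Site P (j + 1)), ns (j + 1) y = ns j (emb y) - meanCLM (Idx P) 𝔸 fun i : Idx P =>
        ns j (emb y) - ((T j y i : 𝔸ˣ) : 𝔸) * ns j (transl (emb y) (disp (stairWord i.2.1 (off i.1)))) * (((T j y i)⁻¹ : 𝔸ˣ) : 𝔸))
    (hns' : ∀ (j : ℕ) (y : Site P (j + 1)), ns' (j + 1) y = ns' j (emb y) - meanCLM (Idx P) 𝔸 fun i : Idx P =>
        ns' j (emb y) - ((T j y i : 𝔸ˣ) : 𝔸) * ns' j (transl (emb y) (disp (stairWord i.2.1 (off i.1)))) * (((T j y i)⁻¹ : 𝔸ˣ) : 𝔸)) :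
    ∀ (j : ℕ), j ≤ P.m + P.K → ∀ y : Site P j, (∀ x : Site P 0, iterBlockOf j x = y → ns 0 x = ns' 0 x) → ns j y = ns' j y
  | 0, _, y, h => h y (iterBlockOf_zero y)
  | j + 1, hj, y, h => by
    have hj' : j ≤ P.m + P.K := by omega
    -- level `j` agrees on the one-level block of `y`
    have key : ∀ z : Site P j, blockOf z = y → ns j z = ns' j z := fun z hz =>
      avgSeq_apply_eq_of_eqOn_iterBlock T ns ns' hns hns' j hj' z fun x hx => h x (by rw [iterBlockOf_succ, hx, hz])
    have hemb : blockOf (emb y) = y := Site.blockOf_emb hj y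
    have hz : ∀ i : Idx P, blockOf (transl (emb y) (disp (stairWord i.2.1 (off i.1)))) = y := fun i => by
      rw [transl_emb_disp_stairWord_eq_blockSite]; exact Site.blockOf_blockSite hj y i.1
    rw [hns, hns', key (emb y) hemb]
    congr 2
    funext i
    rw [key _ (hz i)]

end Generic

/-! ## §2 A symmetric operator preserving a subspace commutes with its orthogonal projection (Mathlib bookkeeping) -/

section Abstract

variable {𝕜 E : Type*} [RCLike 𝕜] [NormedAddCommGroup E] [InnerProductSpace 𝕜 E]

/-- ★ **`T` SYMMETRIC WITH `T(K) ⊆ K` ⟹ `P_K ∘ T = T ∘ P_K`.**  A symmetric map preserving `K` preserves `Kᗮ`, so `T(P_K v) ∈ K` and `T v − T(P_K v) = T(v − P_K v) ∈ Kᗮ`: uniqueness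
of the orthogonal decomposition. [folklore] -/
theorem starProjection_apply_of_isSymmetric_of_mapsTo (K : Submodule 𝕜 E) [K.HasOrthogonalProjection] {T : E →ₗ[𝕜] E} (hT : T.IsSymmetric)
    (hK : ∀ v ∈ K, T v ∈ K) (v : E) : K.starProjection (T v) = T (K.starProjection v) := by
  refine Submodule.eq_starProjection_of_mem_orthogonal (hK _ (K.starProjection_apply_mem v)) ?_
  have hperp : v - K.starProjection v ∈ Kᗮ := K.sub_starProjection_mem_orthogonal v
  rw [Submodule.mem_orthogonal] at hperp ⊢
  intro u hu
  rw [← map_sub, ← hT u, hperp (T u) (hK u hu)]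

end Abstract

/-! ## §3 At the T³ member: the top nested covariant mean of record is block-local; `proj_{ker Q″}` commutes with block cuts; coercivity on `ker Q″` -/

section Member

variable (F : T3Family) {n K : ℕ} {c₀ : ℝ} [Fact (0 < c₀)]
  (U₀ : GaugeField (F.P K) 0 (Matrix.specialUnitaryGroup (Fin 2) ℂ))
  (Q'' : SiteL2K ℂ 3 (periodsT3 F K) c₀ W₂ →ₗ[ℂ] (Site (F.P K) (K - n) → Matrix (Fin 2) (Fin 2) ℂ))
  (hseq : ∀ lam : Site (F.P K) 0 → Matrix (Fin 2) (Fin 2) ℂ, ∃ ns : (j : ℕ) → Site (F.P K) j → Matrix (Fin 2) (Fin 2) ℂ, ns 0 = lam ∧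
      (∀ (j : ℕ) (y : Site (F.P K) (j + 1)), ns (j + 1) y = ns j (emb y) - meanCLM (Idx (F.P K)) (Matrix (Fin 2) (Fin 2) ℂ) fun i : Idx (F.P K) =>
        ns j (emb y) - ((holT (emlIterU j (bgUnits F K U₀)) (emb y) (stairWord i.2.1 (off i.1)) : (Matrix (Fin 2) (Fin 2) ℂ)ˣ) : Matrix (Fin 2) (Fin 2) ℂ) *
          ns j (transl (emb y) (disp (stairWord i.2.1 (off i.1)))) * (((holT (emlIterU j (bgUnits F K U₀)) (emb y) (stairWord i.2.1 (off i.1)))⁻¹ : (Matrix (Fin 2) (Fin 2) ℂ)ˣ) : Matrix (Fin 2) (Fin 2) ℂ)) ∧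
      ns (K - n) = Q'' (toL2S F K c₀ lam))

include hseq

omit [Fact (0 < c₀)] in
/-- ★★ **THE TOP NESTED COVARIANT MEAN OF RECORD IS BLOCK-LOCAL**: for ANY `ℂ`-linear `Q''` with clause (iv) of ✓`exists_intertwiner_of_regPr` (every `λ` has an averaging sequence
with top `Q''(toL2S λ)`), two gauge parameters agreeing on the block `B^{K−n}(y)` have the same top mean at `y` — any background, any transports, no regularity.
[cite: Balaban1985BackgroundPropagators, (3.19) p.393, (3.114)-(3.115) p.418; Balaban1984PropagatorsI, (1.18) p.20] -/
theorem topMean_apply_eq_of_eqOn_iterBlock (lam lam' : Site (F.P K) 0 → Matrix (Fin 2) (Fin 2) ℂ) (y : Site (F.P K) (K - n))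
    (h : ∀ x : Site (F.P K) 0, iterBlockOf (K - n) x = y → lam x = lam' x) :
    Q'' (toL2S F K c₀ lam) y = Q'' (toL2S F K c₀ lam') y := by
  obtain ⟨ns, h0, hs, htop⟩ := hseq lam
  obtain ⟨ns', h0', hs', htop'⟩ := hseq lam'
  have hk : K - n ≤ (F.P K).m + (F.P K).K := by show K - n ≤ F.m + K; omega
  have key := avgSeq_apply_eq_of_eqOn_iterBlock _ ns ns' hs hs' (K - n) hk y fun x hx => by rw [h0, h0']; exact h x hx
  rwa [htop, htop'] at key

omit [Fact (0 < c₀)] in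
/-- ★★ **THE CUT PIECE HAS ITS TOP MEAN CONCENTRATED AT ITS BLOCK**: `Q''(toL2S (𝟙_{B(y)}·λ)) = Pi.single y ((Q''(toL2S λ)) y)` — on `B(y)` the cut agrees with `λ`, on every other block
with `0`. [cite: Balaban1985BackgroundPropagators, (3.19) p.393; Balaban1984PropagatorsI, (1.18) p.20] -/
theorem topMean_cut (lam : Site (F.P K) 0 → Matrix (Fin 2) (Fin 2) ℂ) (y : Site (F.P K) (K - n)) :
    Q'' (toL2S F K c₀ fun x => if iterBlockOf (K - n) x = y then lam x else 0) = Pi.single y (Q'' (toL2S F K c₀ lam) y) := by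
  funext z
  by_cases hz : z = y
  · subst hz
    rw [Pi.single_eq_same]
    exact topMean_apply_eq_of_eqOn_iterBlock F U₀ Q'' hseq _ _ z fun x hx => by rw [if_pos hx]
  · rw [Pi.single_eq_of_ne hz]
    have h0 : Q'' (toL2S F K c₀ fun x => if iterBlockOf (K - n) x = y then lam x else 0) z = Q'' (toL2S F K c₀ 0) z :=
      topMean_apply_eq_of_eqOn_iterBlock F U₀ Q'' hseq _ _ z fun x hx => by rw [if_neg fun hy => hz (hx.symm.trans hy)]; rfl
    rw [h0, map_zero, map_zero]; rfl

omit [Fact (0 < c₀)] in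
/-- ★ **`ker Q″` IS STABLE UNDER BLOCK CUTS**: `Q''(toL2S λ) = 0 ⟹ Q''(toL2S (𝟙_{B(y)}·λ)) = 0`. [cite: Balaban1985BackgroundPropagators, (3.21) p.394] -/
theorem topMean_cut_eq_zero {lam : Site (F.P K) 0 → Matrix (Fin 2) (Fin 2) ℂ} (hlam : Q'' (toL2S F K c₀ lam) = 0) (y : Site (F.P K) (K - n)) :
    Q'' (toL2S F K c₀ fun x => if iterBlockOf (K - n) x = y then lam x else 0) = 0 := by
  rw [topMean_cut F U₀ Q'' hseq, hlam, Pi.zero_apply, Pi.single_zero]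

omit [Fact (0 < c₀)] in
/-- ★ **`ker Q″` IS A PRODUCT OVER BLOCKS**: `λ` has top mean `0` iff every block piece of `λ` does. [cite: Balaban1985BackgroundPropagators, (3.21) p.394; Balaban1984PropagatorsI, (1.18) p.20] -/
theorem topMean_eq_zero_iff_forall_cut (lam : Site (F.P K) 0 → Matrix (Fin 2) (Fin 2) ℂ) :
    Q'' (toL2S F K c₀ lam) = 0 ↔ ∀ y : Site (F.P K) (K - n), Q'' (toL2S F K c₀ fun x => if iterBlockOf (K - n) x = y then lam x else 0) = 0 := by
  refine ⟨fun h y => topMean_cut_eq_zero F U₀ Q'' hseq h y, fun h => ?_⟩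
  funext y
  have hy := congrFun (h y) y
  rw [topMean_cut F U₀ Q'' hseq, Pi.single_eq_same] at hy
  exact hy

/-- ★★★ **THE ORTHOGONAL PROJECTION ONTO `ker Q″` COMMUTES WITH BLOCK CUTS** (block-diagonality of `P_N = proj_{ker Q″}` in the weighted `L²` of the gauge parameters): the cut
`λ ↦ 𝟙_{B(y)}·λ` is a symmetric operator of `SiteL2K` (the pairing ✓`inner_toL2S` is a pointwise sum) mapping `ker Q″` into itself (`topMean_cut_eq_zero`), so §2 applies.
[cite: Balaban1985BackgroundPropagators, (3.21) p.394, (3.49) p.399] -/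
theorem starProjection_ker_cut_comm (lam : Site (F.P K) 0 → Matrix (Fin 2) (Fin 2) ℂ) (y : Site (F.P K) (K - n)) :
    (LinearMap.ker Q'').starProjection (toL2S F K c₀ fun x => if iterBlockOf (K - n) x = y then lam x else 0)
      = toL2S F K c₀ fun x => if iterBlockOf (K - n) x = y then (toL2S F K c₀).symm ((LinearMap.ker Q'').starProjection (toL2S F K c₀ lam)) x else 0 := by
  -- the cut on the route's functions, as a linear map
  have hcut : ∃ C₀ : (Site (F.P K) 0 → Matrix (Fin 2) (Fin 2) ℂ) →ₗ[ℂ] (Site (F.P K) 0 → Matrix (Fin 2) (Fin 2) ℂ),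
      ∀ l x, C₀ l x = if iterBlockOf (K - n) x = y then l x else 0 := by
    refine ⟨{ toFun := fun l x => if iterBlockOf (K - n) x = y then l x else 0, map_add' := ?_, map_smul' := ?_ }, fun l x => rfl⟩
    · intro l l'; funext x; simp only [Pi.add_apply]; split_ifs <;> simp
    · intro a l; funext x; simp only [Pi.smul_apply, RingHom.id_apply]; split_ifs <;> simp
  obtain ⟨C₀, hC₀⟩ := hcut
  -- transported to `SiteL2K`
  obtain ⟨C, hC⟩ : ∃ C : SiteL2K ℂ 3 (periodsT3 F K) c₀ W₂ →ₗ[ℂ] SiteL2K ℂ 3 (periodsT3 F K) c₀ W₂,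
      ∀ l : Site (F.P K) 0 → Matrix (Fin 2) (Fin 2) ℂ, C (toL2S F K c₀ l) = toL2S F K c₀ fun x => if iterBlockOf (K - n) x = y then l x else 0 := by
    refine ⟨(toL2S F K c₀).toLinearMap ∘ₗ C₀ ∘ₗ (toL2S F K c₀).symm.toLinearMap, fun l => ?_⟩
    show toL2S F K c₀ (C₀ ((toL2S F K c₀).symm (toL2S F K c₀ l))) = _
    rw [LinearEquiv.symm_apply_apply]
    exact congrArg _ (funext fun x => hC₀ l x)
  -- `C` is symmetric
  have hsymm : C.IsSymmetric := by
    intro v w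
    obtain ⟨l, rfl⟩ : ∃ l, v = toL2S F K c₀ l := ⟨(toL2S F K c₀).symm v, ((toL2S F K c₀).apply_symm_apply v).symm⟩
    obtain ⟨l', rfl⟩ : ∃ l', w = toL2S F K c₀ l' := ⟨(toL2S F K c₀).symm w, ((toL2S F K c₀).apply_symm_apply w).symm⟩
    rw [hC, hC, inner_toL2S, inner_toL2S]
    refine congrArg (fun s : ℂ => (c₀ : ℂ) * s) (Finset.sum_congr rfl fun x _ => ?_)
    split_ifs <;> simp
  -- `C` preserves `ker Q''`
  have hker : ∀ v ∈ LinearMap.ker Q'', C v ∈ LinearMap.ker Q'' := by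
    intro v hv
    obtain ⟨l, rfl⟩ : ∃ l, v = toL2S F K c₀ l := ⟨(toL2S F K c₀).symm v, ((toL2S F K c₀).apply_symm_apply v).symm⟩
    rw [hC, LinearMap.mem_ker]
    exact topMean_cut_eq_zero F U₀ Q'' hseq (LinearMap.mem_ker.1 hv) y
  have hcomm := starProjection_apply_of_isSymmetric_of_mapsTo (LinearMap.ker Q'') hsymm hker (toL2S F K c₀ lam)
  rw [hC] at hcomm
  rw [hcomm, ← hC ((toL2S F K c₀).symm ((LinearMap.ker Q'').starProjection (toL2S F K c₀ lam))), LinearEquiv.apply_symm_apply]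

/-- ★★ **THE PROJECTION OF A BLOCK-SUPPORTED PARAMETER IS SUPPORTED IN THE SAME BLOCK**: if `λ` vanishes off `B^{K−n}(y)`, so does `P_N(toL2S λ)` read back on the sites.
[cite: Balaban1985BackgroundPropagators, (3.21) p.394, (3.49) p.399] -/
theorem starProjection_ker_apply_eq_zero_off_block (lam : Site (F.P K) 0 → Matrix (Fin 2) (Fin 2) ℂ) (y : Site (F.P K) (K - n))
    (hlam : ∀ x : Site (F.P K) 0, iterBlockOf (K - n) x ≠ y → lam x = 0) (x : Site (F.P K) 0) (hx : iterBlockOf (K - n) x ≠ y) :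
    (toL2S F K c₀).symm ((LinearMap.ker Q'').starProjection (toL2S F K c₀ lam)) x = 0 := by
  have hcut : lam = fun z => if iterBlockOf (K - n) z = y then lam z else 0 := by
    funext z
    split_ifs with h
    · rfl
    · exact hlam z h
  rw [hcut, starProjection_ker_cut_comm F U₀ Q'' hseq, LinearEquiv.symm_apply_apply, if_neg hx]

/-- ★★ **OFF-BLOCK MATRIX ENTRIES OF `proj_{ker Q″}` VANISH**: for `λ` supported in `B^{K−n}(y)` and `λ'` supported off it, `⟪toL2S λ', P_N (toL2S λ)⟫ = 0` — the
`hPr : 0 < d i l → Pm i l = 0` row of ✓`Prop7ProjRangeKernelDecayCT.R_decay` for `Pm := proj_{ker Q″}` in any site-supported orthonormal family, block pseudo-metric.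
[cite: Balaban1985BackgroundPropagators, (3.21) p.394, (3.49) p.399] -/
theorem inner_starProjection_ker_eq_zero_of_support (lam lam' : Site (F.P K) 0 → Matrix (Fin 2) (Fin 2) ℂ) (y : Site (F.P K) (K - n))
    (hlam : ∀ x : Site (F.P K) 0, iterBlockOf (K - n) x ≠ y → lam x = 0) (hlam' : ∀ x : Site (F.P K) 0, iterBlockOf (K - n) x = y → lam' x = 0) :
    ⟪toL2S F K c₀ lam', (LinearMap.ker Q'').starProjection (toL2S F K c₀ lam)⟫_ℂ = 0 := by
  obtain ⟨g, hg⟩ : ∃ g : Site (F.P K) 0 → Matrix (Fin 2) (Fin 2) ℂ, (LinearMap.ker Q'').starProjection (toL2S F K c₀ lam) = toL2S F K c₀ g :=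
    ⟨(toL2S F K c₀).symm ((LinearMap.ker Q'').starProjection (toL2S F K c₀ lam)), ((toL2S F K c₀).apply_symm_apply _).symm⟩
  have hg0 : ∀ x : Site (F.P K) 0, iterBlockOf (K - n) x ≠ y → g x = 0 := fun x hx => by
    have h := starProjection_ker_apply_eq_zero_off_block F U₀ Q'' hseq lam y hlam x hx
    rwa [hg, LinearEquiv.symm_apply_apply] at h
  rw [hg, inner_toL2S, Finset.sum_eq_zero, mul_zero]
  intro x _
  by_cases hx : iterBlockOf (K - n) x = y
  · rw [hlam' x hx, Matrix.conjTranspose_zero, Matrix.zero_mul, Matrix.trace_zero]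
  · rw [hg0 x hx, Matrix.mul_zero, Matrix.trace_zero]

/-- ★★ **SPIKE VERSION**: for sites `x`, `x'` in DIFFERENT `(K−n)`-blocks and any fibre values `A`, `B`, `⟪toL2S (δ_{x'}⊗B), P_N (toL2S (δ_x⊗A))⟫ = 0` — `proj_{ker Q″}` is block-diagonal
in the site⊗fibre letters. [cite: Balaban1985BackgroundPropagators, (3.21) p.394, (3.49) p.399] -/
theorem inner_starProjection_ker_eq_zero_of_iterBlockOf_ne {x x' : Site (F.P K) 0} (hxx' : iterBlockOf (K - n) x ≠ iterBlockOf (K - n) x')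
    (A B : Matrix (Fin 2) (Fin 2) ℂ) :
    ⟪toL2S F K c₀ (Pi.single x' B), (LinearMap.ker Q'').starProjection (toL2S F K c₀ (Pi.single x A))⟫_ℂ = 0 := by
  refine inner_starProjection_ker_eq_zero_of_support F U₀ Q'' hseq (Pi.single x A) (Pi.single x' B) (iterBlockOf (K - n) x)
    (fun z hz => ?_) (fun z hz => ?_)
  · have hne : z ≠ x := fun h => hz (congrArg (iterBlockOf (K - n)) h)
    rw [Pi.single_eq_of_ne hne]
  · have hne : z ≠ x' := fun h => hxx' (by subst h; exact hz.symm)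
    rw [Pi.single_eq_of_ne hne]

/-- ★ **COERCIVITY ON `ker Q″`, GRADIENT FORM**: at a printed-regular background (`10⁷L³ε₀ ≤ 1`), `‖P_N v‖² ≤ 2·‖D_{U₀}(P_N v)‖²` for every `v` — ✓p746531 (L1) on the range of the
projection (`c_P² = ½`, volume-free). [cite: Balaban1983RegularityDecay, (2.27) p.580; Balaban1985BackgroundPropagators, Thm 3.11 p.416] -/
theorem normSq_starProjection_ker_le_two_mul {ε₀ : ℝ} (hε₀ : 0 < ε₀) (hε7 : 10 ^ 7 * (F.L : ℝ) ^ 3 * ε₀ ≤ 1) (hreg : RegPr F n K ε₀ U₀)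
    (v : SiteL2K ℂ 3 (periodsT3 F K) c₀ W₂) :
    ‖(LinearMap.ker Q'').starProjection v‖ ^ 2 ≤ 2 * ‖DL2 F n K c₀ U₀ ((LinearMap.ker Q'').starProjection v)‖ ^ 2 := by
  obtain ⟨lam, hlam⟩ : ∃ lam : Site (F.P K) 0 → Matrix (Fin 2) (Fin 2) ℂ, toL2S F K c₀ lam = (LinearMap.ker Q'').starProjection v :=
    ⟨(toL2S F K c₀).symm _, (toL2S F K c₀).apply_symm_apply _⟩
  rw [← hlam]
  refine normSq_le_two_mul_normSq_DL2_of_topMean_eq_zero F hε₀ hε7 U₀ hreg Q'' hseq lam ?_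
  rw [hlam]
  exact LinearMap.mem_ker.1 ((LinearMap.ker Q'').starProjection_apply_mem v)

/-- ★ **COERCIVITY ON `ker Q″`, LAPLACIAN FORM** (the `hcoer` of ✓`Prop7ProjRangeKernelDecayCT.accretive_S` with `c = ½`, and the coercivity input of any Agmon form): at a printed-regular
background, `‖P_N v‖ ≤ 2·‖Δ^η_{U₀}(P_N v)‖` — from the gradient form by `‖Dw‖² = re⟪w, Δw⟫ ≤ ‖w‖·‖Δw‖` (✓`inner_covLapSite`, Cauchy–Schwarz).
[cite: Balaban1985BackgroundPropagators, (3.23) p.394, Thm 3.11 p.416; Balaban1983RegularityDecay, (2.27) p.580] -/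
theorem norm_starProjection_ker_le_two_mul_norm_covLapSite {ε₀ : ℝ} (hε₀ : 0 < ε₀) (hε7 : 10 ^ 7 * (F.L : ℝ) ^ 3 * ε₀ ≤ 1) (hreg : RegPr F n K ε₀ U₀)
    (v : SiteL2K ℂ 3 (periodsT3 F K) c₀ W₂) :
    ‖(LinearMap.ker Q'').starProjection v‖ ≤ 2 * ‖covLapSite F n K c₀ U₀ ((LinearMap.ker Q'').starProjection v)‖ := by
  have h1 := normSq_starProjection_ker_le_two_mul F U₀ Q'' hseq hε₀ hε7 hreg v
  generalize (LinearMap.ker Q'').starProjection v = w at h1 ⊢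
  have h2 : ‖DL2 F n K c₀ U₀ w‖ ^ 2 = RCLike.re ⟪w, covLapSite F n K c₀ U₀ w⟫_ℂ := by
    rw [inner_covLapSite]
    norm_cast
  have h3 : RCLike.re ⟪w, covLapSite F n K c₀ U₀ w⟫_ℂ ≤ ‖w‖ * ‖covLapSite F n K c₀ U₀ w‖ := re_inner_le_norm w _
  have h4 : ‖w‖ * ‖w‖ ≤ ‖w‖ * (2 * ‖covLapSite F n K c₀ U₀ w‖) := by nlinarith [h1, h2, h3]
  rcases (norm_nonneg w).eq_or_lt with h0 | hpos
  · rw [← h0]; positivity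
  · exact le_of_mul_le_mul_left h4 hpos

end Member

end Summit.QuantumFields.YangMills.Theorems.Prop7TopMeanBlockLocal

end
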